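import Summits.BirchSwinnertonDyer.Rank1Residual.Additive.X3LineDatumOfKernelPolyCert
import HarnessLib

/-!
# X3♯(G-ord, `e = 2`) at `p ≥ 5`: the END STATES with the per-pair line datum packaged as
# `CaseOneDatum W p` — the doors that the kernel records `caseOneDatum_<member>` plug into
# (cell `bsd-addord`, seat `bsd-addord-twist`)

HONEST FRAMING (cell `bsd-addord`, `run/shared/lean/pub/bsd-addord/README.md` §4): the programme's
target of record is the full Birch–Swinnerton-Dyer formula for every `E/ℚ` of analytic rank `≤ 1`.
THEOREMS ONLY (no definition, no named fact, no `sorry`): each theorem is an EXISTING `p ≥ 5` door of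
`X3BranchGordEndStateRamifiedLine.lean` with the four line-datum binders `(Φ₀, hΦ, heven, hram)`
replaced by ONE hypothesis `hD : CaseOneDatum W p` (`Additive/X3CaseOneMember.lean`); every published
input stays an explicit named-fact binder; nothing is asserted about any curve; nothing is booked.

## What

With the records `KernelPolyLineRecords.caseOneDatum_<member> (hmin) (hX) (he) : CaseOneDatum W p`
(`X3LineDatum{Five,Seven,Thirteen}Records*.lean`) the per-pair datum of a booked row is a kernel
theorem; composing with these doors gives `BSDp W p` / the isogenous-class form by name from the
class binders, the published facts and the rank data alone:
* §1 rank `0`: `ClassX3Gord.bsdp_rankZero_of_facts_of_nonAnomalous_of_caseOneDatum`,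
  `ClassX3Gord.bsdp_rankZero_of_facts_intrinsic_of_caseOneDatum`,
  `ClassX3Gord.bsdp_of_isIsogenous_of_facts_intrinsic_of_caseOneDatum` (Cassels);
* §2 rank `1`: `ClassX3Gord.bsdp_rankOne_of_facts_of_cycLineFact_intrinsic_of_branchCoeffOneNeZero{,Odd}_of_caseOneDatum`
  (gz's DisegniLine doors, `p ≡ 1, 3 (mod 4)`).
The unpacking is `KernelPolyLine.exists_of_caseOneDatum`.

References: as in the wrapped doors [GreenbergVatsal2000, Wuthrich2014, Delbourgo1998, Delbourgo2002,
Disegni2017, Mazur1972Towers, Miller2011LMS, MilneADT2006].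
-/

set_option autoImplicit false

noncomputable section

open scoped Classical MatrixGroups ModularForm NumberField

open CongruenceSubgroup WeierstrassCurve NumberField IsDedekindDomain Field
  Literature.NumberTheory.EllipticCurves Literature.NumberTheory.EllipticCurves.ModularForms
  Literature.NumberTheory.EllipticCurves.GreenbergVatsal2000
  Literature.NumberTheory.EllipticCurves.Rank1Residual
  Literature.NumberTheory.EllipticCurves.Rank1Residual.Typed
  Literature.NumberTheory.EllipticCurves.Delbourgo2002
  Literature.NumberTheory.EllipticCurves.Disegni2017
  Literature.NumberTheory.GaloisRepresentations
  Summit.BirchSwinnertonDyer.Rank1Residual.AdditivePotMult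
  Summit.BirchSwinnertonDyer.Rank1Residual.Additive.X3Branch
  Summit.BirchSwinnertonDyer.Rank1Residual.Additive.KernelPolyLine

namespace Summit.BirchSwinnertonDyer.Rank1Residual.Additive

variable {W W' : WeierstrassCurve ℚ} [W.IsElliptic] [W.IsGloballyMinimal] [W'.IsElliptic]
  [W'.IsGloballyMinimal] {p : ℕ} [hp : Fact p.Prime]

/-! ## §1 Rank `0` -/

omit [W'.IsElliptic] [W'.IsGloballyMinimal] in
/-- **p401882's `BSDp` door at `p ≥ 5` on a Case-1 datum** (non-anomalous rows): Miller's `BSD(E,p)` on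
X3♯(G-ord) ∩ `I₀*` ∩ `r_an = 0` ∩ ¬CM ∩ non-anomalous from the published facts + `CaseOneDatum W p`.
[cite: GreenbergVatsal2000, §2 (11), (16), §3 Thm. (3.12)] [cite: Wuthrich2014, Thm. 16 (p. 397)]
[cite: Delbourgo1998, Prop. 4 (p. 144)] [cite: Delbourgo2002, Theorem (A), (B) (p. 40)]
[cite: Miller2011LMS, Def. 1.1] -/
theorem ClassX3Gord.bsdp_rankZero_of_facts_of_nonAnomalous_of_caseOneDatum
    (hW16 : Wuthrich2014.thm16_halfEigenCharIdeal_dvd_cyclotomicPrime)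
    (hGV : thm312_branch_unitContent_and_lambda_eq_residual_goodOrd)
    (h23 : datumSelmer_nonPrimitive_invariants)
    (h414 : Greenberg1999.prop414_noFiniteSubmodule_of_not_dvd_torsionOrder)
    (hGrK : Greenberg1999.imKummer_ge_strictCondition_goodOrdinary)
    (hLiftF : residualEpsilon_surjOn_of_lineRamifiedEven)
    (hDel98 : Delbourgo1998.prop4_rankZero_pow_dvd_constantCoeff) (hDel : Delbourgo2002.mainTheorem)
    (hGZK : rank_eq_analyticRank_of_analyticRank_le_one) (hmod : hasEntireLFunction_rat)
    (hmodD : nonempty_modularParametrizationData)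
    (hX : ClassX3Gord W p) (hcm : ¬ W.HasCM) (hp5 : 5 ≤ p) (he : semistabilityIndex W p = 2)
    (hr : W.analyticRank = 0) (hna : Delbourgo2002.ReductionNonAnomalous W p)
    (hD : CaseOneDatum W p) : BSDp W p := by
  obtain ⟨Φ₀, hΦ, -, heven, hram⟩ := exists_of_caseOneDatum hp5 hD
  exact ClassX3Gord.bsdp_rankZero_of_facts_of_nonAnomalous_ram0Free hW16 hGV h23 h414 hGrK hLiftF hDel98
    hDel hGZK hmod hmodD hX hcm hp5 he hr hna Φ₀ hΦ heven hram

omit [W'.IsElliptic] [W'.IsGloballyMinimal] in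
/-- **p404507's `BSDp` door at `p ≥ 5` on a Case-1 datum** (anomalous rows included): Miller's `BSD(E,p)`
on X3♯(G-ord) ∩ `I₀*` ∩ `r_an = 0` from the published facts + `CaseOneDatum W p`.
[cite: GreenbergVatsal2000, §2 (11), (16), §3 Thm. (3.12)] [cite: Wuthrich2014, Thm. 16 (p. 397)]
[cite: Delbourgo1998, Prop. 4 (p. 144)] [cite: Miller2011LMS, Def. 1.1] -/
theorem ClassX3Gord.bsdp_rankZero_of_facts_intrinsic_of_caseOneDatum
    (hW16 : Wuthrich2014.thm16_halfEigenCharIdeal_dvd_cyclotomicPrime)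
    (hGV : thm312_branch_unitContent_and_lambda_eq_residual_goodOrd)
    (h23 : datumSelmer_nonPrimitive_invariants)
    (h414 : Greenberg1999.prop414_noFiniteSubmodule_of_not_dvd_torsionOrder)
    (hGrK : Greenberg1999.imKummer_ge_strictCondition_goodOrdinary)
    (hLiftF : residualEpsilon_surjOn_of_lineRamifiedEven)
    (hDelG : Delbourgo1998.prop4_rankZero_constantCoeff_eq_unit_mul_of_potGoodOrd)
    (hDel98 : Delbourgo1998.prop4_rankZero_pow_dvd_constantCoeff)
    (hGZK : rank_eq_analyticRank_of_analyticRank_le_one) (hmod : hasEntireLFunction_rat)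
    (hmodD : nonempty_modularParametrizationData)
    (hX : ClassX3Gord W p) (hp5 : 5 ≤ p) (he : semistabilityIndex W p = 2) (hr : W.analyticRank = 0)
    (hD : CaseOneDatum W p) : BSDp W p := by
  obtain ⟨Φ₀, hΦ, -, heven, hram⟩ := exists_of_caseOneDatum hp5 hD
  exact ClassX3Gord.bsdp_rankZero_of_facts_intrinsic_ram0Free hW16 hGV h23 h414 hGrK hLiftF hDelG hDel98
    hGZK hmod hmodD hX hp5 he hr Φ₀ hΦ heven hram

/-- **p404918's class door at `p ≥ 5` on a Case-1 datum**: `BSD(E,p)` for EVERY member `W` of the class of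
a Case-1 member `W'` (`CaseOneDatum W' p`, `r_an = 0`), by Cassels.
[cite: GreenbergVatsal2000, §2 (11), (16), §3 Thm. (3.12)] [cite: MilneADT2006, Thm. I.7.3]
[cite: Miller2011LMS, Def. 1.1] -/
theorem ClassX3Gord.bsdp_of_isIsogenous_of_facts_intrinsic_of_caseOneDatum
    (hCassels : bsdRHS_eq_of_isIsogenous)
    (hW16 : Wuthrich2014.thm16_halfEigenCharIdeal_dvd_cyclotomicPrime)
    (hGV : thm312_branch_unitContent_and_lambda_eq_residual_goodOrd)
    (h23 : datumSelmer_nonPrimitive_invariants)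
    (h414 : Greenberg1999.prop414_noFiniteSubmodule_of_not_dvd_torsionOrder)
    (hGrK : Greenberg1999.imKummer_ge_strictCondition_goodOrdinary)
    (hLiftF : residualEpsilon_surjOn_of_lineRamifiedEven)
    (hDelG : Delbourgo1998.prop4_rankZero_constantCoeff_eq_unit_mul_of_potGoodOrd)
    (hDel98 : Delbourgo1998.prop4_rankZero_pow_dvd_constantCoeff)
    (hGZK : rank_eq_analyticRank_of_analyticRank_le_one) (hmod : hasEntireLFunction_rat)
    (hmodD : nonempty_modularParametrizationData)
    (hiso : IsIsogenous W W')
    (hX' : ClassX3Gord W' p) (hp5 : 5 ≤ p) (he' : semistabilityIndex W' p = 2) (hr' : W'.analyticRank = 0)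
    (hD : CaseOneDatum W' p) : BSDp W p := by
  obtain ⟨Φ₀, hΦ, -, heven, hram⟩ := exists_of_caseOneDatum hp5 hD
  exact ClassX3Gord.bsdp_of_isIsogenous_of_facts_intrinsic_ram0Free hCassels hW16 hGV h23 h414 hGrK hLiftF
    hDelG hDel98 hGZK hmod hmodD hiso hX' hp5 he' hr' Φ₀ hΦ heven hram

/-! ## §2 Rank `1` -/

omit [W'.IsElliptic] [W'.IsGloballyMinimal] in
/-- **gz's DisegniLine door, EVEN branch (`p ≡ 1 (mod 4)`, `p ≥ 5`), on a Case-1 datum**: Miller's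
`BSD(E,p)` on X3♯(G-ord) ∩ `I₀*` ∩ `r_an = 1` ∩ ¬CM from the published facts + `CaseOneDatum W p` +
`A′ ≠ 0`. [cite: Disegni2017, Theorem B] [cite: Mazur1972Towers, Cor. 5.15]
[cite: Delbourgo2002, Theorem (A), (B) (p. 40)] [cite: GreenbergVatsal2000, §2 (11), (16), §3 Thm. (3.12)]
[cite: Miller2011LMS, Def. 1.1] -/
theorem ClassX3Gord.bsdp_rankOne_of_facts_of_cycLineFact_intrinsic_of_branchCoeffOneNeZero_of_caseOneDatum
    (hW16 : Wuthrich2014.thm16_halfEigenCharIdeal_dvd_cyclotomicPrime)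
    (hGV : thm312_branch_unitContent_and_lambda_eq_residual_goodOrd)
    (h23 : datumSelmer_nonPrimitive_invariants)
    (h414 : Greenberg1999.prop414_noFiniteSubmodule_of_not_dvd_torsionOrder)
    (hGrK : Greenberg1999.imKummer_ge_strictCondition_goodOrdinary)
    (hLiftF : residualEpsilon_surjOn_of_lineRamifiedEven)
    (hMaz : Mazur1972.cor515_universalNormIndex)
    (hCyc : delbourgoDatum_cycLineGrossZagier)
    (hArt : rankinSelbergEulerProductHecke_baseChangeDirichlet_eq) (h73 : GrossZagier1986_thm_I_7_3)
    (hWald : waldspurger_exists_heegnerField_twist_ne_zero)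
    (hDel : Delbourgo2002.mainTheorem) (hmod : hasEntireLFunction_rat)
    (hmodD : nonempty_modularParametrizationData) (hmodN : exists_isNewformOf)
    (hGZK : rank_eq_analyticRank_of_analyticRank_le_one)
    (hX : ClassX3Gord W p) (he : semistabilityIndex W p = 2) (hp4 : p % 4 = 1) (hp5 : 5 ≤ p)
    (hcm : ¬ W.HasCM) (hr : W.analyticRank = 1) (hD : CaseOneDatum W p)
    (hne : BranchCoeffOneNeZeroAt W p) : BSDp W p := by
  obtain ⟨Φ₀, hΦ, -, heven, hram⟩ := exists_of_caseOneDatum hp5 hD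
  exact ClassX3Gord.bsdp_rankOne_of_facts_of_cycLineFact_intrinsic_of_branchCoeffOneNeZero_ram0Free hW16
    hGV h23 h414 hGrK hLiftF hMaz hCyc hArt h73 hWald hDel hmod hmodD hmodN hGZK hX he hp4 hcm hr Φ₀ hΦ
    heven hram hne

omit [W'.IsElliptic] [W'.IsGloballyMinimal] in
/-- **gz's DisegniLine door, ODD branch (`p ≡ 3 (mod 4)`, `p ≥ 5`), on a Case-1 datum**: Miller's
`BSD(E,p)` on X3♯(G-ord) ∩ `I₀*` ∩ `r_an = 1` ∩ ¬CM from the published facts + `CaseOneDatum W p` +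
`A′ ≠ 0`. [cite: Disegni2017, Theorem B] [cite: Mazur1972Towers, Cor. 5.15]
[cite: Delbourgo2002, Theorem (A), (B) (p. 40)] [cite: GreenbergVatsal2000, §2 (11), (16), §3 Thm. (3.12)]
[cite: Miller2011LMS, Def. 1.1] -/
theorem ClassX3Gord.bsdp_rankOne_of_facts_of_cycLineFact_intrinsic_of_branchCoeffOneNeZeroOdd_of_caseOneDatum
    (hW16 : Wuthrich2014.thm16_halfEigenCharIdeal_dvd_cyclotomicPrime)
    (hGV : thm312_branch_unitContent_and_lambda_eq_residual_goodOrd)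
    (h23 : datumSelmer_nonPrimitive_invariants)
    (h414 : Greenberg1999.prop414_noFiniteSubmodule_of_not_dvd_torsionOrder)
    (hGrK : Greenberg1999.imKummer_ge_strictCondition_goodOrdinary)
    (hLiftF : residualEpsilon_surjOn_of_lineRamifiedEven)
    (hMaz : Mazur1972.cor515_universalNormIndex)
    (hCyc : delbourgoDatum_cycLineGrossZagier)
    (hArt : rankinSelbergEulerProductHecke_baseChangeDirichlet_eq) (h73 : GrossZagier1986_thm_I_7_3)
    (hWald : waldspurger_exists_heegnerField_twist_ne_zero)
    (hDel : Delbourgo2002.mainTheorem) (hmod : hasEntireLFunction_rat)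
    (hmodD : nonempty_modularParametrizationData) (hmodN : exists_isNewformOf)
    (hGZK : rank_eq_analyticRank_of_analyticRank_le_one)
    (hX : ClassX3Gord W p) (he : semistabilityIndex W p = 2) (hp4 : p % 4 = 3) (hp5 : 5 ≤ p)
    (hcm : ¬ W.HasCM) (hr : W.analyticRank = 1) (hD : CaseOneDatum W p)
    (hne : BranchCoeffOneNeZeroAt W p) : BSDp W p := by
  obtain ⟨Φ₀, hΦ, -, heven, hram⟩ := exists_of_caseOneDatum hp5 hD
  exact ClassX3Gord.bsdp_rankOne_of_facts_of_cycLineFact_intrinsic_of_branchCoeffOneNeZeroOdd_ram0Free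
    hW16 hGV h23 h414 hGrK hLiftF hMaz hCyc hArt h73 hWald hDel hmod hmodD hmodN hGZK hX he hp4 hp5 hcm hr
    Φ₀ hΦ heven hram hne

end Summit.BirchSwinnertonDyer.Rank1Residual.Additive

end
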